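import Mathlib
import Summits.AtomisticToContinuum.FouriersLaw.Theorems.ParityLiouvilleSeedCesaroUpgradeCutoff
import Summits.AtomisticToContinuum.FouriersLaw.Theorems.ParityLiouvilleSeedCesaroUpgradeSiteEnergy
import HarnessLib

/-!
# Cesàro upgrade, helper 7: bond independence of the mean current

Support file for item `stmt-AtomisticToContinuum-13981` (`ParityLiouvilleSeed.CesaroUpgrade`).

Growth bounds for the site energy of `pinnedChain ω₂ lam β γ` and its partial derivatives along
the box `{x-1, x, x+1}` (all `≤ (3 + |ω₂| + |lam| + 8|β|) (1 + ‖box_R σ‖)⁴`, `R = |x| + 2`), and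
the consequence of the cut-off lemma (`…Cutoff`) and the continuity equation (`…SiteEnergy`):
in a time-invariant probability measure with site-uniform moments of all orders the mean current
is BOND INDEPENDENT, `∫ j_{x-1} dν = ∫ j_x dν` (`integral_bondCurrentZ_pred_eq`), in particular
`∫ j₀ ∘ τ^k dν = ∫ j₀ dν` for every `k` (`integral_bondCurrentZ_comp_shift_iterate`), the input
of the Cesàro average. No definitions.
-/

noncomputable section

namespace Summit.AtomisticToContinuum.FouriersLaw.Theorems.CesaroUpgrade

open MeasureTheory Filter Topology Set
open Literature.MathematicalPhysics.KineticTheory.HeatConduction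

section PinnedChain

variable (ω₂ lam β γ : ℝ)

/-- Coordinates of the sites `x - 1, x, x + 1` are dominated by the box norm of radius `|x| + 2`.
[folklore] -/
theorem abs_coord_le_of_near (x : ℤ) (σ : ChainConfig) {z : ℤ} (hz : |z - x| ≤ 1) :
    |(σ z).1| ≤ ‖boxRestrict (x.natAbs + 2) σ‖ ∧ |(σ z).2| ≤ ‖boxRestrict (x.natAbs + 2) σ‖ := by
  have hR : |z| ≤ ((x.natAbs + 2 : ℕ) : ℤ) := by
    push_cast
    have := abs_sub_abs_le_abs_sub z x
    linarith
  exact ⟨abs_fst_le_norm_boxRestrict hR σ, abs_snd_le_norm_boxRestrict hR σ⟩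

/-- Quartic bound for the pinning potential: `|U(q)| ≤ (|ω₂| + |lam|) S⁴` for `|q| ≤ S`, `1 ≤ S`.
[folklore] -/
theorem abs_pinnedChain_U_le {q S : ℝ} (hS : 1 ≤ S) (hq : |q| ≤ S) :
    |(pinnedChain ω₂ lam β γ).U q| ≤ (|ω₂| + |lam|) * S ^ 4 := by
  change |ω₂ * q ^ 2 / 2 + lam * q ^ 4 / 4| ≤ _
  have hS2 : S ^ 2 ≤ S ^ 4 := pow_le_pow_right₀ hS (by norm_num)
  have h2 : q ^ 2 ≤ S ^ 4 := by
    refine le_trans ?_ hS2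
    rw [← sq_abs]; exact pow_le_pow_left₀ (abs_nonneg _) hq 2
  have h4 : q ^ 4 ≤ S ^ 4 := by
    rw [show q ^ 4 = |q| ^ 4 by rw [pow_abs, abs_of_nonneg (by positivity)]]
    exact pow_le_pow_left₀ (abs_nonneg _) hq 4
  have hS4 : 0 ≤ S ^ 4 := by positivity
  calc |ω₂ * q ^ 2 / 2 + lam * q ^ 4 / 4| ≤ |ω₂| * q ^ 2 / 2 + |lam| * q ^ 4 / 4 := by
        refine (abs_add_le _ _).trans ?_
        rw [abs_div, abs_div, abs_mul, abs_mul, abs_of_nonneg (by positivity : (0:ℝ) ≤ q ^ 2),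
          abs_of_nonneg (by positivity : (0:ℝ) ≤ q ^ 4), abs_two,
          abs_of_nonneg (by norm_num : (0:ℝ) ≤ 4)]
    _ ≤ |ω₂| * S ^ 4 / 2 + |lam| * S ^ 4 / 4 := by gcongr
    _ ≤ (|ω₂| + |lam|) * S ^ 4 := by
        nlinarith [abs_nonneg ω₂, abs_nonneg lam]

/-- Quartic bound for the coupling potential on differences: `|V(a - b)| ≤ (2 + 4|β|) S⁴` for
`|a|, |b| ≤ S`, `1 ≤ S`. [folklore] -/
theorem abs_pinnedChain_V_sub_le {a b S : ℝ} (hS : 1 ≤ S) (ha : |a| ≤ S) (hb : |b| ≤ S) :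
    |(pinnedChain ω₂ lam β γ).V (a - b)| ≤ (2 + 4 * |β|) * S ^ 4 := by
  change |(a - b) ^ 2 / 2 + β * (a - b) ^ 4 / 4| ≤ _
  have hab : |a - b| ≤ 2 * S := by
    have := abs_sub a b; linarith
  have h2 : (a - b) ^ 2 ≤ (2 * S) ^ 2 := by
    rw [← sq_abs]; exact pow_le_pow_left₀ (abs_nonneg _) hab 2
  have h4 : (a - b) ^ 4 ≤ (2 * S) ^ 4 := by
    rw [show (a - b) ^ 4 = |a - b| ^ 4 by rw [pow_abs, abs_of_nonneg (by positivity)]]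
    exact pow_le_pow_left₀ (abs_nonneg _) hab 4
  have hS2 : S ^ 2 ≤ S ^ 4 := pow_le_pow_right₀ hS (by norm_num)
  calc |(a - b) ^ 2 / 2 + β * (a - b) ^ 4 / 4| ≤ (a - b) ^ 2 / 2 + |β| * (a - b) ^ 4 / 4 := by
        refine (abs_add_le _ _).trans ?_
        rw [abs_div, abs_div, abs_mul, abs_of_nonneg (by positivity : (0:ℝ) ≤ (a - b) ^ 2),
          abs_of_nonneg (by positivity : (0:ℝ) ≤ (a - b) ^ 4), abs_two,
          abs_of_nonneg (by norm_num : (0:ℝ) ≤ 4)]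
    _ ≤ (2 * S) ^ 2 / 2 + |β| * (2 * S) ^ 4 / 4 := by gcongr
    _ = 2 * S ^ 2 + 4 * |β| * S ^ 4 := by ring
    _ ≤ 2 * S ^ 4 + 4 * |β| * S ^ 4 := by gcongr
    _ = (2 + 4 * |β|) * S ^ 4 := by ring

/-- Quartic bounds for `U'` and `V'`: `|U'(q)| ≤ (|ω₂| + |lam|) S⁴`, `|V'(a - b)| ≤ (2 + 8|β|) S⁴`
for `|q|, |a|, |b| ≤ S - 1`... stated with `|·| ≤ M`, `S = 1 + M`. [folklore] -/
theorem abs_pinnedChain_derivs_le {M : ℝ} (hM : 0 ≤ M) :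
    (∀ q : ℝ, |q| ≤ M → |deriv (pinnedChain ω₂ lam β γ).U q| ≤ (|ω₂| + |lam|) * (1 + M) ^ 4) ∧
      ∀ a b : ℝ, |a| ≤ M → |b| ≤ M →
        |deriv (pinnedChain ω₂ lam β γ).V (a - b)| ≤ (2 + 8 * |β|) * (1 + M) ^ 4 := by
  have hS1 : (1 : ℝ) ≤ 1 + M := by linarith
  have hS3 : (1 + M) ^ 3 ≤ (1 + M) ^ 4 := pow_le_pow_right₀ hS1 (by norm_num)
  have hS14 : (1 + M) ≤ (1 + M) ^ 4 := by
    calc (1 + M) = (1 + M) ^ 1 := (pow_one _).symm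
      _ ≤ (1 + M) ^ 4 := pow_le_pow_right₀ hS1 (by norm_num)
  refine ⟨fun q hq => ?_, fun a b ha hb => ?_⟩
  · rw [pinnedChain_deriv_U]
    have hqS : |q| ≤ 1 + M := by linarith
    have h3 : |q| ^ 3 ≤ (1 + M) ^ 3 := pow_le_pow_left₀ (abs_nonneg _) hqS 3
    calc |ω₂ * q + lam * q ^ 3| ≤ |ω₂| * |q| + |lam| * |q| ^ 3 := by
          refine (abs_add_le _ _).trans ?_
          rw [abs_mul, abs_mul, abs_pow]
      _ ≤ |ω₂| * (1 + M) + |lam| * (1 + M) ^ 3 := by gcongr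
      _ ≤ |ω₂| * (1 + M) ^ 4 + |lam| * (1 + M) ^ 4 := by gcongr
      _ = (|ω₂| + |lam|) * (1 + M) ^ 4 := by ring
  · rw [pinnedChain_deriv_V]
    calc |a - b + β * (a - b) ^ 3| ≤ (2 + 8 * |β|) * (1 + M) ^ 3 :=
          abs_pinnedChain_deriv_V_sub_le β hM ha hb
      _ ≤ (2 + 8 * |β|) * (1 + M) ^ 4 := mul_le_mul_of_nonneg_left hS3 (by positivity)

/-- **Growth of the site energy** along the box `{x-1, x, x+1}`:
`|e_x(σ)| ≤ (3 + |ω₂| + |lam| + 8|β|) (1 + ‖box_R σ‖)⁴`, `R = |x| + 2`. [folklore] -/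
theorem abs_siteEnergy_le (x : ℤ) (σ : ChainConfig) :
    |(fun y : Fin (2 + 1) → ℝ × ℝ =>
      (y 1).2 ^ 2 / 2 + (pinnedChain ω₂ lam β γ).U (y 1).1 +
        ((pinnedChain ω₂ lam β γ).V ((y 2).1 - (y 1).1) +
          (pinnedChain ω₂ lam β γ).V ((y 1).1 - (y 0).1)) / 2) (boxRestrictAt (x - 1) 2 σ)| ≤
      (3 + |ω₂| + |lam| + 8 * |β|) * (1 + ‖boxRestrict (x.natAbs + 2) σ‖) ^ 4 := by
  set M : ℝ := ‖boxRestrict (x.natAbs + 2) σ‖ with hM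
  have hM0 : 0 ≤ M := norm_nonneg _
  have hS1 : (1 : ℝ) ≤ 1 + M := by linarith
  obtain ⟨hq, hp⟩ := abs_coord_le_of_near x σ (z := x) (by simp)
  obtain ⟨hq1, -⟩ := abs_coord_le_of_near x σ (z := x + 1) (by simp)
  obtain ⟨hqm, -⟩ := abs_coord_le_of_near x σ (z := x - 1) (by simp)
  rw [← hM] at hq hp hq1 hqm
  have hqS : |(σ x).1| ≤ 1 + M := by linarith
  have hpS : |(σ x).2| ≤ 1 + M := by linarith
  have hq1S : |(σ (x + 1)).1| ≤ 1 + M := by linarith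
  have hqmS : |(σ (x - 1)).1| ≤ 1 + M := by linarith
  have e0 : boxRestrictAt (x - 1) 2 σ 0 = σ (x - 1) := by simp [boxRestrictAt_apply]
  have e1 : boxRestrictAt (x - 1) 2 σ 1 = σ x := by simp [boxRestrictAt_apply]
  have e2 : boxRestrictAt (x - 1) 2 σ 2 = σ (x + 1) := by
    simp only [boxRestrictAt_apply, Fin.val_two, Nat.cast_ofNat]; congr 1; ring
  simp only [e0, e1, e2]
  have hS2 : (1 + M) ^ 2 ≤ (1 + M) ^ 4 := pow_le_pow_right₀ hS1 (by norm_num)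
  have hp2 : (σ x).2 ^ 2 ≤ (1 + M) ^ 4 := by
    refine le_trans ?_ hS2
    rw [← sq_abs]; exact pow_le_pow_left₀ (abs_nonneg _) hpS 2
  have hU := abs_pinnedChain_U_le ω₂ lam β γ hS1 hqS
  have hV1 := abs_pinnedChain_V_sub_le ω₂ lam β γ hS1 hq1S hqS
  have hV2 := abs_pinnedChain_V_sub_le ω₂ lam β γ hS1 hqS hqmS
  have hS4 : 0 ≤ (1 + M) ^ 4 := by positivity
  calc _ ≤ |(σ x).2 ^ 2 / 2 + (pinnedChain ω₂ lam β γ).U (σ x).1| +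
        |((pinnedChain ω₂ lam β γ).V ((σ (x + 1)).1 - (σ x).1) +
          (pinnedChain ω₂ lam β γ).V ((σ x).1 - (σ (x - 1)).1)) / 2| := abs_add_le _ _
    _ ≤ (|(σ x).2 ^ 2 / 2| + |(pinnedChain ω₂ lam β γ).U (σ x).1|) +
        (|(pinnedChain ω₂ lam β γ).V ((σ (x + 1)).1 - (σ x).1)| +
          |(pinnedChain ω₂ lam β γ).V ((σ x).1 - (σ (x - 1)).1)|) / 2 := by
        refine add_le_add (abs_add_le _ _) ?_
        rw [abs_div, abs_two]
        exact div_le_div_of_nonneg_right (abs_add_le _ _) zero_le_two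
    _ ≤ ((1 + M) ^ 4 / 2 + (|ω₂| + |lam|) * (1 + M) ^ 4) +
        ((2 + 4 * |β|) * (1 + M) ^ 4 + (2 + 4 * |β|) * (1 + M) ^ 4) / 2 := by
        have : |(σ x).2 ^ 2 / 2| ≤ (1 + M) ^ 4 / 2 := by
          rw [abs_div, abs_two, abs_of_nonneg (by positivity : (0 : ℝ) ≤ (σ x).2 ^ 2)]
          linarith
        gcongr
    _ = (1 / 2 + |ω₂| + |lam| + 2 + 4 * |β|) * (1 + M) ^ 4 := by ring
    _ ≤ (3 + |ω₂| + |lam| + 8 * |β|) * (1 + M) ^ 4 := by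
        refine mul_le_mul_of_nonneg_right ?_ hS4
        linarith [abs_nonneg β]

/-- **Growth of the partial derivatives of the site energy** along the box `{x-1, x, x+1}`
(each `≤ (3 + |ω₂| + |lam| + 8|β|) (1 + ‖box_R σ‖)⁴`, `R = |x| + 2`). [folklore] -/
theorem abs_partial_siteEnergy_le (x : ℤ) (σ : ChainConfig) {z : ℤ} (hz1 : x - 1 ≤ z)
    (hz2 : z ≤ x - 1 + (2 : ℕ)) :
    |partialQZ z ((fun y : Fin (2 + 1) → ℝ × ℝ =>
        (y 1).2 ^ 2 / 2 + (pinnedChain ω₂ lam β γ).U (y 1).1 +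
          ((pinnedChain ω₂ lam β γ).V ((y 2).1 - (y 1).1) +
            (pinnedChain ω₂ lam β γ).V ((y 1).1 - (y 0).1)) / 2) ∘ boxRestrictAt (x - 1) 2) σ| ≤
      (3 + |ω₂| + |lam| + 8 * |β|) * (1 + ‖boxRestrict (x.natAbs + 2) σ‖) ^ 4 ∧
    |partialPZ z ((fun y : Fin (2 + 1) → ℝ × ℝ =>
        (y 1).2 ^ 2 / 2 + (pinnedChain ω₂ lam β γ).U (y 1).1 +
          ((pinnedChain ω₂ lam β γ).V ((y 2).1 - (y 1).1) +
            (pinnedChain ω₂ lam β γ).V ((y 1).1 - (y 0).1)) / 2) ∘ boxRestrictAt (x - 1) 2) σ| ≤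
      (3 + |ω₂| + |lam| + 8 * |β|) * (1 + ‖boxRestrict (x.natAbs + 2) σ‖) ^ 4 := by
  obtain ⟨p0q, p0p, p1q, p1p, p2q, p2p⟩ := partial_siteEnergy ω₂ lam β γ x σ
  set M : ℝ := ‖boxRestrict (x.natAbs + 2) σ‖ with hM
  have hM0 : 0 ≤ M := norm_nonneg _
  have hS1 : (1 : ℝ) ≤ 1 + M := by linarith
  obtain ⟨hq, hp⟩ := abs_coord_le_of_near x σ (z := x) (by simp)
  obtain ⟨hq1, -⟩ := abs_coord_le_of_near x σ (z := x + 1) (by simp)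
  obtain ⟨hqm, -⟩ := abs_coord_le_of_near x σ (z := x - 1) (by simp)
  rw [← hM] at hq hp hq1 hqm
  obtain ⟨hU', hV'⟩ := abs_pinnedChain_derivs_le ω₂ lam β γ hM0
  have hS4 : 0 ≤ (1 + M) ^ 4 := by positivity
  have hK1 : (1 : ℝ) ≤ 3 + |ω₂| + |lam| + 8 * |β| := by
    linarith [abs_nonneg ω₂, abs_nonneg lam, abs_nonneg β]
  have hK2 : (2 + 8 * |β|) / 2 ≤ 3 + |ω₂| + |lam| + 8 * |β| := by
    linarith [abs_nonneg ω₂, abs_nonneg lam, abs_nonneg β]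
  have hK3 : |ω₂| + |lam| + (2 + 8 * |β|) ≤ 3 + |ω₂| + |lam| + 8 * |β| := by linarith
  have hS14 : (1 + M) ≤ (1 + M) ^ 4 := by
    calc (1 + M) = (1 + M) ^ 1 := (pow_one _).symm
      _ ≤ (1 + M) ^ 4 := pow_le_pow_right₀ hS1 (by norm_num)
  have hhalf : ∀ r : ℝ, |deriv (pinnedChain ω₂ lam β γ).V r| ≤ (2 + 8 * |β|) * (1 + M) ^ 4 →
      |deriv (pinnedChain ω₂ lam β γ).V r / 2| ≤ (3 + |ω₂| + |lam| + 8 * |β|) * (1 + M) ^ 4 := by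
    intro r hr
    rw [abs_div, abs_two]
    calc |deriv (pinnedChain ω₂ lam β γ).V r| / 2 ≤ (2 + 8 * |β|) * (1 + M) ^ 4 / 2 := by gcongr
      _ = (2 + 8 * |β|) / 2 * (1 + M) ^ 4 := by ring
      _ ≤ _ := mul_le_mul_of_nonneg_right hK2 hS4
  have hzero : |(0 : ℝ)| ≤ (3 + |ω₂| + |lam| + 8 * |β|) * (1 + M) ^ 4 := by
    rw [abs_zero]; exact mul_nonneg (by linarith) hS4
  rcases (show z = x - 1 ∨ z = x ∨ z = x + 1 by push_cast at hz2; omega) with hz | hz | hz <;>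
    rw [hz]
  · refine ⟨?_, ?_⟩
    · rw [p0q, neg_div, abs_neg]
      exact hhalf _ (hV' _ _ hq hqm)
    · rw [p0p]; exact hzero
  · refine ⟨?_, ?_⟩
    · rw [p1q]
      calc _ ≤ |deriv (pinnedChain ω₂ lam β γ).U (σ x).1 -
            deriv (pinnedChain ω₂ lam β γ).V ((σ (x + 1)).1 - (σ x).1) / 2| +
            |deriv (pinnedChain ω₂ lam β γ).V ((σ x).1 - (σ (x - 1)).1) / 2| := abs_add_le _ _
        _ ≤ (|deriv (pinnedChain ω₂ lam β γ).U (σ x).1| +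
            |deriv (pinnedChain ω₂ lam β γ).V ((σ (x + 1)).1 - (σ x).1) / 2|) +
            |deriv (pinnedChain ω₂ lam β γ).V ((σ x).1 - (σ (x - 1)).1) / 2| :=
            add_le_add (abs_sub _ _) le_rfl
        _ ≤ ((|ω₂| + |lam|) * (1 + M) ^ 4 + (2 + 8 * |β|) * (1 + M) ^ 4 / 2) +
            (2 + 8 * |β|) * (1 + M) ^ 4 / 2 := by
            rw [abs_div, abs_two, abs_div, abs_two]
            have h0 := hU' _ hq
            have h1 := hV' _ _ hq1 hq
            have h2 := hV' _ _ hq hqm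
            gcongr
        _ = ((|ω₂| + |lam|) + (2 + 8 * |β|)) * (1 + M) ^ 4 := by ring
        _ ≤ _ := mul_le_mul_of_nonneg_right hK3 hS4
    · rw [p1p]
      calc |(σ x).2| ≤ 1 + M := by linarith
        _ ≤ 1 * (1 + M) ^ 4 := by rw [one_mul]; exact hS14
        _ ≤ _ := mul_le_mul_of_nonneg_right hK1 hS4
  · refine ⟨?_, ?_⟩
    · rw [p2q]
      exact hhalf _ (hV' _ _ hq1 hq)
    · rw [p2p]; exact hzero


/-! ### Bond independence of the mean current -/

/-- **Bond independence of the mean current**: in a time-invariant state of the pinned chain with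
site-uniform moments of all orders, `∫ j_{x-1} dν = ∫ j_x dν` (the continuity equation
`𝒜e_x = j_{x-1} - j_x` integrated against `ν`, via the cut-off lemma). [folklore] -/
theorem integral_bondCurrentZ_pred_eq {ν : Measure ChainConfig} [IsProbabilityMeasure ν]
    (hTI : IsTimeInvariant (pinnedChain ω₂ lam β γ) ν)
    (hmom : ∀ m : ℕ, ∃ C : ℝ, ∀ x : ℤ,
      Integrable (fun σ : ChainConfig => |(σ x).1| ^ m + |(σ x).2| ^ m) ν ∧
        ∫ σ, (|(σ x).1| ^ m + |(σ x).2| ^ m) ∂ν ≤ C) (x : ℤ) :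
    ∫ σ, (pinnedChain ω₂ lam β γ).bondCurrentZ σ (x - 1) ∂ν =
      ∫ σ, (pinnedChain ω₂ lam β γ).bondCurrentZ σ x ∂ν := by
  obtain ⟨C4, hC4⟩ := hmom 4
  have hjint : ∀ z : ℤ, Integrable (fun σ => (pinnedChain ω₂ lam β γ).bondCurrentZ σ z) ν := by
    intro z
    have hz : |z| + 1 ≤ ((z.natAbs + 1 : ℕ) : ℤ) := by push_cast; omega
    exact (integrable_of_abs_le_growth (fun σ => abs_pinnedChain_bondCurrentZ_le ω₂ lam β γ hz σ)
      (continuous_pinnedChain_bondCurrentZ ω₂ lam β γ z).aestronglyMeasurable hC4).1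
  have ha : |x - 1| + 1 ≤ ((x.natAbs + 2 : ℕ) : ℤ) := by
    push_cast
    have := abs_sub x 1
    rw [abs_one] at this
    linarith
  have han : |x - 1 + ((2 : ℕ) : ℤ)| + 1 ≤ ((x.natAbs + 2 : ℕ) : ℤ) := by
    push_cast
    have := abs_add_le x 1
    rw [abs_one] at this
    have e : x - 1 + 2 = x + 1 := by ring
    rw [e]
    linarith
  obtain ⟨-, hzero⟩ := integral_liouvilleZ_comp_eq_zero_of_growth ω₂ lam β γ hTI hmom ha han
    (contDiff_siteEnergyProfile ω₂ lam β γ) (K := 3 + |ω₂| + |lam| + 8 * |β|) (d := 4)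
    (fun σ => abs_siteEnergy_le ω₂ lam β γ x σ)
    (fun σ z hz1 hz2 => (abs_partial_siteEnergy_le ω₂ lam β γ x σ hz1 hz2).1)
    (fun σ z hz1 hz2 => (abs_partial_siteEnergy_le ω₂ lam β γ x σ hz1 hz2).2)
  rw [funext (liouvilleZ_siteEnergy_eq ω₂ lam β γ x), integral_sub (hjint _) (hjint _)] at hzero
  linarith

/-- The mean current is the same through every bond to the right of the origin:
`∫ j_k dν = ∫ j_0 dν`. [folklore] -/
theorem integral_bondCurrentZ_nat_eq {ν : Measure ChainConfig} [IsProbabilityMeasure ν]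
    (hTI : IsTimeInvariant (pinnedChain ω₂ lam β γ) ν)
    (hmom : ∀ m : ℕ, ∃ C : ℝ, ∀ x : ℤ,
      Integrable (fun σ : ChainConfig => |(σ x).1| ^ m + |(σ x).2| ^ m) ν ∧
        ∫ σ, (|(σ x).1| ^ m + |(σ x).2| ^ m) ∂ν ≤ C) (k : ℕ) :
    ∫ σ, (pinnedChain ω₂ lam β γ).bondCurrentZ σ k ∂ν =
      ∫ σ, (pinnedChain ω₂ lam β γ).bondCurrentZ σ 0 ∂ν := by
  induction k with
  | zero => simp
  | succ k ih =>
    rw [← ih]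
    have h := integral_bondCurrentZ_pred_eq ω₂ lam β γ hTI hmom ((k : ℤ) + 1)
    rw [add_sub_cancel_right] at h
    push_cast
    exact h.symm

/-- Iterated shift covariance of the bond current: `j_x(τ^k σ) = j_{x+k}(σ)`. [folklore] -/
theorem bondCurrentZ_shift_iterate (P : OscillatorChain) (k : ℕ) (σ : ChainConfig) (x : ℤ) :
    P.bondCurrentZ ((shift^[k]) σ) x = P.bondCurrentZ σ (x + k) := by
  induction k generalizing σ x with
  | zero => simp
  | succ k ih =>
    rw [Function.iterate_succ_apply, ih, bondCurrentZ_shift]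
    congr 1; push_cast; ring

/-- **Bond independence, shift form**: `∫ j_0 ∘ τ^k dν = ∫ j_0 dν` for every `k`, the input of
the Cesàro average. [folklore] -/
theorem integral_bondCurrentZ_comp_shift_iterate {ν : Measure ChainConfig} [IsProbabilityMeasure ν]
    (hTI : IsTimeInvariant (pinnedChain ω₂ lam β γ) ν)
    (hmom : ∀ m : ℕ, ∃ C : ℝ, ∀ x : ℤ,
      Integrable (fun σ : ChainConfig => |(σ x).1| ^ m + |(σ x).2| ^ m) ν ∧
        ∫ σ, (|(σ x).1| ^ m + |(σ x).2| ^ m) ∂ν ≤ C) (k : ℕ) :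
    ∫ σ, (pinnedChain ω₂ lam β γ).bondCurrentZ ((shift^[k]) σ) 0 ∂ν =
      ∫ σ, (pinnedChain ω₂ lam β γ).bondCurrentZ σ 0 ∂ν := by
  simp only [bondCurrentZ_shift_iterate, zero_add]
  exact integral_bondCurrentZ_nat_eq ω₂ lam β γ hTI hmom k

end PinnedChain

end Summit.AtomisticToContinuum.FouriersLaw.Theorems.CesaroUpgrade

end
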